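import Summits.CriticalPhenomena.PercolationContinuityZ3.Theses.PercShatteringRace
import Literature.Probability.Percolation.SharpnessDCTProofs
import HarnessLib

/-!
# Crux `PercShatteringRace.NearLinearTwoClusterDecay` (stmt-CriticalPhenomena-5785), line `critical-orange-peeling` — stub `crossing_le_sum_faces`

Helper file for the lead's skeleton of the line `critical-orange-peeling` (van den Berg–van
Engelenburg 2022 programme, bounded aspect; arXiv:2009.13337, Lemma 6 / Prop. 2, bond version on
`ℤ³`) of the crux
`Summit.CriticalPhenomena.PercolationContinuityZ3.Theses.PercShatteringRace.NearLinearTwoClusterDecay`.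
Proves exactly the registered stub signature `crossing_le_sum_faces` (item V7b of the skeleton,
the FACE DECOMPOSITION); lands with `--supports stmt-CriticalPhenomena-5785`.

## The statement

Bond percolation `P_p` on `ℤ³`, any `p`. Write `Λ(n) = box 3 n = [-n, n]³`,
`cross(n, m) = {∃ x ∈ Λ(n), ∃ y ∈ ∂ⁱⁿΛ(m), x ↔ y by an open path inside Λ(m)}` and, for a
coordinate `i` and `1 ≤ a < b`,
`E⁺ᵢ(a, b) = {∃ x ∈ Λ(b) ∩ {vᵢ = a}, ∃ y ∈ Λ(b) ∩ {vᵢ = b}, x ↔ y by an open path inside Λ(b) ∩ {vᵢ ≥ a}}`,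
`E⁻ᵢ(a, b)` its mirror image (`vᵢ = -a`, `vᵢ = -b`, inside `Λ(b) ∩ {vᵢ ≤ -a}`). Then
`P_p(cross(a - 1, b)) ≤ Σ_{i < 3} (P_p(E⁺ᵢ(a, b)) + P_p(E⁻ᵢ(a, b)))`.

## The argument (pure path combinatorics and the union bound)

* INCLUSION (`FaceDecomposition.mem_iUnion_faces`), on lattice configurations `ω ⊆ E(ℤ³)` (which
  carry full measure, `DCT16.real_mono_of_forall_subset_edgeSet`). Let `γ` be an open path inside
  `Λ(b)` from `x ∈ Λ(a - 1)` to `y ∈ ∂ⁱⁿΛ(b)` (`DCT16.pathIn_of_mem_openConnIn`). Some coordinate of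
  `y` equals `± b` (`exists_eq_of_mem_innerBoundary_box`); say `yᵢ = b` (the case `yᵢ = -b` is the
  mirror image). Follow `γ` BACKWARDS from `y` and stop at its first exit from the half-space
  `{vᵢ ≥ a}` (`PathIn.exit`; it does exit, since `xᵢ ≤ a - 1`): the exit edge `u ∼ u'` has
  `uᵢ ≥ a > u'ᵢ` and is a lattice edge, so `|uᵢ - u'ᵢ| ≤ 1` (`DCT16.abs_sub_le_one_of_adj`) forces
  `uᵢ = a`, and the segment of `γ` between `u` and `y` is an open path inside `Λ(b) ∩ {vᵢ ≥ a}`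
  (`FaceDecomposition.exists_levelPath_of_lt_of_le`). Hence `ω ∈ E⁺ᵢ(a, b)`.
* UNION BOUND: `P(⋃ᵢ (E⁺ᵢ ∪ E⁻ᵢ)) ≤ Σᵢ (P(E⁺ᵢ) + P(E⁻ᵢ))` (`measureReal_iUnion_fintype_le`,
  `measureReal_union_le`).

No symmetry and no independence is used; no new definitions.
-/

noncomputable section

namespace Summit.CriticalPhenomena.PercolationContinuityZ3.Theorems.NearLinearTwoClusterDecay.Negative

open MeasureTheory Filter Topology
open Literature.Probability.LatticeModels Literature.Probability.Percolation

namespace FaceDecomposition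

/-! ### Path combinatorics: the last visit below a level -/

/-- **Level crossing, upward.** On a lattice configuration `ω ⊆ E(ℤ^d)`, an open path inside `A`
from `x` with `xᵢ < c` to `y` with `yᵢ ≥ c` contains a vertex `w` with `wᵢ = c` such that its
segment from `w` to `y` is an open path inside `A ∩ {vᵢ ≥ c}`: reverse the path and take its first
exit from `{vᵢ ≥ c}` (`PathIn.exit`); the exit edge is a lattice edge, so its coordinates change by
at most one (`DCT16.abs_sub_le_one_of_adj`) and its inner endpoint lies exactly at level `c`. -/
theorem exists_levelPath_of_lt_of_le {d : ℕ} {ω : BondConfig (Site d)}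
    (hω : ω ⊆ (zdGraph d).edgeSet) {A : Set (Site d)} {x y : Site d}
    (h : PathIn (openGraph ω) A x y) (i : Fin d) (c : ℤ) (hx : x i < c) (hy : c ≤ y i) :
    ∃ w, w i = c ∧ PathIn (openGraph ω) ({v : Site d | c ≤ v i} ∩ A) w y := by
  obtain ⟨u, u', hu, hu', -, hadj, hpath⟩ :=
    h.symm.exit (R := {v : Site d | c ≤ v i}) hy (not_le.2 hx)
  have h1 := DCT16.abs_sub_le_one_of_adj (DCT16.adj_of_openGraph_adj hω hadj) i
  rw [abs_le] at h1
  have hu1 : c ≤ u i := hu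
  have hu2 : ¬ c ≤ u' i := hu'
  exact ⟨u, by omega, hpath.symm⟩

/-- **Level crossing, downward** (mirror image of `exists_levelPath_of_lt_of_le`): an open path
inside `A` from `x` with `xᵢ > c` to `y` with `yᵢ ≤ c` contains a vertex `w` with `wᵢ = c` whose
segment to `y` is an open path inside `A ∩ {vᵢ ≤ c}`. -/
theorem exists_levelPath_of_gt_of_ge {d : ℕ} {ω : BondConfig (Site d)}
    (hω : ω ⊆ (zdGraph d).edgeSet) {A : Set (Site d)} {x y : Site d}
    (h : PathIn (openGraph ω) A x y) (i : Fin d) (c : ℤ) (hx : c < x i) (hy : y i ≤ c) :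
    ∃ w, w i = c ∧ PathIn (openGraph ω) ({v : Site d | v i ≤ c} ∩ A) w y := by
  obtain ⟨u, u', hu, hu', -, hadj, hpath⟩ :=
    h.symm.exit (R := {v : Site d | v i ≤ c}) hy (not_le.2 hx)
  have h1 := DCT16.abs_sub_le_one_of_adj (DCT16.adj_of_openGraph_adj hω hadj) i
  rw [abs_le] at h1
  have hu1 : u i ≤ c := hu
  have hu2 : ¬ u' i ≤ c := hu'
  exact ⟨u, by omega, hpath.symm⟩

/-! ### The inclusion `cross(a - 1, b) ⊆ ⋃ᵢ (E⁺ᵢ(a, b) ∪ E⁻ᵢ(a, b))` on lattice configurations -/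

/-- **Face decomposition of a box crossing** (any dimension `d`). On a lattice configuration
`ω ⊆ E(ℤ^d)`, if `Λ(a - 1)` is joined to `∂ⁱⁿΛ(b)` by an open path inside `Λ(b)` (`1 ≤ a < b`), then
for some coordinate `i` either the layer `Λ(b) ∩ {vᵢ = a}` is joined to the face `Λ(b) ∩ {vᵢ = b}`
inside `Λ(b) ∩ {vᵢ ≥ a}`, or the layer `Λ(b) ∩ {vᵢ = -a}` is joined to the face `Λ(b) ∩ {vᵢ = -b}`
inside `Λ(b) ∩ {vᵢ ≤ -a}`: the endpoint on `∂ⁱⁿΛ(b)` has a coordinate `yᵢ = ± b`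
(`exists_eq_of_mem_innerBoundary_box`), and the last visit of the path to `{vᵢ ≤ a - 1}`
(resp. `{vᵢ ≥ -(a - 1)}`) is followed by a vertex at level exactly `± a`
(`exists_levelPath_of_lt_of_le`, `exists_levelPath_of_gt_of_ge`). -/
theorem mem_iUnion_faces {d a b : ℕ} (ha : 1 ≤ a) (hab : a < b) {ω : BondConfig (Site d)}
    (hω : ω ⊆ (zdGraph d).edgeSet)
    (h : ω ∈ {ω | ∃ x ∈ box d (a - 1), ∃ y ∈ innerBoundary (zdGraph d) (box d b),
      ω ∈ openConnIn (↑(box d b) : Set (Site d)) x y}) :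
    ω ∈ ⋃ i : Fin d,
      ({ω | ∃ x ∈ (box d b).filter (fun v => v i = (a : ℤ)),
          ∃ y ∈ (box d b).filter (fun v => v i = (b : ℤ)),
            ω ∈ openConnIn (↑((box d b).filter (fun v => (a : ℤ) ≤ v i)) : Set (Site d)) x y} ∪
        {ω | ∃ x ∈ (box d b).filter (fun v => v i = -(a : ℤ)),
          ∃ y ∈ (box d b).filter (fun v => v i = -(b : ℤ)),
            ω ∈ openConnIn (↑((box d b).filter (fun v => v i ≤ -(a : ℤ))) : Set (Site d)) x y}) := by
  obtain ⟨x, hx, y, hy, hxy⟩ := h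
  have P := DCT16.pathIn_of_mem_openConnIn hxy
  have hyb : y ∈ box d b := (mem_innerBoundary_iff.1 hy).1
  rw [mem_box] at hx
  obtain ⟨i, hi | hi⟩ := exists_eq_of_mem_innerBoundary_box hy
  · -- `yᵢ = b`: the path ends on the face `{vᵢ = b}`
    have hxi := (hx i).2
    obtain ⟨w, hw, Q⟩ := exists_levelPath_of_lt_of_le hω P i (a : ℤ) (by omega)
      (by rw [hi]; omega)
    refine Set.mem_iUnion.2 ⟨i, Or.inl ⟨w, Finset.mem_filter.2 ⟨Q.left_mem.2, hw⟩, y,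
      Finset.mem_filter.2 ⟨hyb, hi⟩, DCT16.mem_openConnIn_of_pathIn (Q.mono ?_)⟩⟩
    exact fun v hv => Finset.mem_coe.2 (Finset.mem_filter.2 ⟨hv.2, hv.1⟩)
  · -- `yᵢ = -b`: the path ends on the face `{vᵢ = -b}`
    have hxi := (hx i).1
    obtain ⟨w, hw, Q⟩ := exists_levelPath_of_gt_of_ge hω P i (-(a : ℤ)) (by omega)
      (by rw [hi]; omega)
    refine Set.mem_iUnion.2 ⟨i, Or.inr ⟨w, Finset.mem_filter.2 ⟨Q.left_mem.2, hw⟩, y,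
      Finset.mem_filter.2 ⟨hyb, hi⟩, DCT16.mem_openConnIn_of_pathIn (Q.mono ?_)⟩⟩
    exact fun v hv => Finset.mem_coe.2 (Finset.mem_filter.2 ⟨hv.2, hv.1⟩)

end FaceDecomposition

/-- **V7b (`crossing_le_sum_faces`)**, registered stub of the line `critical-orange-peeling` of
crux stmt-CriticalPhenomena-5785 — the FACE DECOMPOSITION: for bond percolation on `ℤ³`, any `p`
and `1 ≤ a < b`,
`P_p(Λ(a-1) ↔ ∂ⁱⁿΛ(b) inside Λ(b)) ≤ Σ_{i < 3} (P_p(E⁺ᵢ(a, b)) + P_p(E⁻ᵢ(a, b)))`, where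
`E⁺ᵢ(a, b)` is the event that the layer `Λ(b) ∩ {vᵢ = a}` is joined to the face `Λ(b) ∩ {vᵢ = b}`
by an open path inside `Λ(b) ∩ {vᵢ ≥ a}` and `E⁻ᵢ(a, b)` is its mirror image. Proof: on lattice
configurations the crossing event is contained in `⋃ᵢ (E⁺ᵢ ∪ E⁻ᵢ)`
(`FaceDecomposition.mem_iUnion_faces`: the endpoint on `∂ⁱⁿΛ(b)` lies on a face `{vᵢ = ± b}`, and
the last visit of the path below level `a` in the coordinate `i` is followed by a vertex at level
exactly `a`), then the union bound (`measureReal_iUnion_fintype_le`, `measureReal_union_le`). -/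
theorem crossing_le_sum_faces : ∀ (p : unitInterval) (a b : ℕ), 1 ≤ a → a < b →
    (bondPercolation (zdGraph 3) p).real
        {ω | ∃ x ∈ box 3 (a - 1), ∃ y ∈ innerBoundary (zdGraph 3) (box 3 b),
          ω ∈ openConnIn (↑(box 3 b) : Set (Site 3)) x y} ≤
      ∑ i : Fin 3,
        ((bondPercolation (zdGraph 3) p).real
          {ω | ∃ x ∈ (box 3 b).filter (fun v => v i = (a : ℤ)), ∃ y ∈ (box 3 b).filter (fun v => v i = (b : ℤ)),
            ω ∈ openConnIn (↑((box 3 b).filter (fun v => (a : ℤ) ≤ v i)) : Set (Site 3)) x y} +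
        (bondPercolation (zdGraph 3) p).real
          {ω | ∃ x ∈ (box 3 b).filter (fun v => v i = -(a : ℤ)), ∃ y ∈ (box 3 b).filter (fun v => v i = -(b : ℤ)),
            ω ∈ openConnIn (↑((box 3 b).filter (fun v => v i ≤ -(a : ℤ))) : Set (Site 3)) x y}) := by
  intro p a b ha hab
  -- inclusion on lattice configurations, then `P(⋃ᵢ (E⁺ᵢ ∪ E⁻ᵢ)) ≤ Σᵢ (P(E⁺ᵢ) + P(E⁻ᵢ))`
  exact (DCT16.real_mono_of_forall_subset_edgeSet (zdGraph 3) p fun ω hω h =>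
    FaceDecomposition.mem_iUnion_faces ha hab hω h).trans
    ((measureReal_iUnion_fintype_le _).trans
      (Finset.sum_le_sum fun _ _ => measureReal_union_le _ _))

end Summit.CriticalPhenomena.PercolationContinuityZ3.Theorems.NearLinearTwoClusterDecay.Negative

end
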